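import Summits.BirchSwinnertonDyer.BirchSwinnertonDyer.Theses.CycTangentCM
import Literature.NumberTheory.EllipticCurves.DeShalit1987.SplitPrimeMuVanishing
import Literature.NumberTheory.EllipticCurves.Rubin1991.TwoVariableCMLines
import Literature.NumberTheory.EllipticCurves.ComplexMultiplicationDeuringGrossencharacter

/-!
# Crux idea `katzside7` on item stmt-BirchSwinnertonDyer-20614 (`PrintX11a.UpperNonSurjFive`) — typed sketch

Ideator bsd-idea-17 gen 3 (lens = transfer). PUBLISH-ONLY scratch (W-79: never registered with
`ledger skeleton check`; the line of record on 20614 stays `Lines/finemu5.lean`). No summit statement is proved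
here; BSD is not proved; nothing below closes any item. No `sorry`, no new axiom, no instance, no notation.

WHAT IS TYPED.
* `CycKatzUnitContentAt p` — the TRANSFER TARGET C⁺ of the card: for every imaginary quadratic `K`, every
  `5 ≤ p` split in `K` (`v ≠ v̄` above `p`), every Hecke character `ψ` of `K` of infinity type `(1,0)` unramified
  at `p` (exact modulus `S ∌ v, v̄`), every generator pair `(κ₁, κ₂; γ₁, γ₂)` of the `ℤ_p²`-extension of `K`
  with `κ₂` CYCLOTOMIC (γ₂ normalised), every admissible period triple and every `G` in the `ψ⁻¹`-twisted
  two-variable Katz–de Shalit frame `IsKatzMeasure₂`: the inner (cyclotomic) line `G(0,T₂) = constantCoeff G`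
  has UNIT CONTENT (`μ = 0`). Binders = VERBATIM those of the tree fact
  `Rubin1991.sec12_padicLFunction_eq_unit_mul_cyclotomicLine` / of `Theses.CycTangentCM.CycTangentBound`
  with the CM anchor curve `A/ℚ` REMOVED (general `ψ`, any class number of `K`, any field of values of `ψ`).
  It is the common generalisation of (i) the OPEN stub `stub_unitContentCycAxis` of line «katz-cyc-axis» on
  K6's crux 19234 `MuZeroCMCurves` (13 CM `j`-invariants over `ℚ`, `h_K = 1`) and (ii) the analytic `μ = 0`
  input of the IMAGINARY-DIHEDRAL sub-locus of U5 (`ρ̄_{E,p} ≅ Ind_K^ℚ ψ̄`, `K` imaginary, `p ∈ {5,7}` split: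
  all 13 known 5Ns pairs and all 5 known 7Ns pairs of X11a, `K = ℚ(i), ℚ(√−11), ℚ(√−19), ℚ(√−131)`), reached
  through the CM NEWFORM member `θ_ψ` of the Hida family `H(ρ̄_E)` (Emerton–Pollack–Weston 2006 Thm 1) — a
  door that needs no CM CURVE partner and is therefore uniform in `h_K` (at the five `p = 7` pairs `h_K = 5`).
* `katzAxis_of_cycKatzUnitContentAt` — PROVED (instantiation): C⁺ at `p` gives the Katz-side reading of
  K6's crux 19234 for every CM anchor package at `p` (the conclusion of «katz-cyc-axis»'s open stub), via the
  tree lemma `Deuring_exists_heckeCharacter_of_maximalCM.isImaginaryQuadratic`.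
* `cycKatzUnitContentAt_iff_residue` — PROVED (bookkeeping): unit content of the inner line is
  non-vanishing of its reduction modulo the maximal ideal of `𝒪_{ℂ_p}` (tree lemma
  `hasUnitContent_iff_map_residue_ne_zero`), i.e. `T₁ ∤ Ḡ` in `𝔽̄_p⟦T₁,T₂⟧` — the form in which the
  card states the first non-transferring step of Gillard's proof (Sinnott independence along the diagonal).
-/

set_option linter.dupNamespace false

namespace Summit.BirchSwinnertonDyer.BirchSwinnertonDyer.Cruxes.UpperNonSurjFive.KatzSide

open Literature.NumberTheory.EllipticCurves Literature.NumberTheory.GaloisRepresentations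
  Literature.NumberTheory.EllipticCurves.GreenbergVatsal2000

/-- **C⁺ (transfer target of card `katzside7`): cyclotomic-line unit content of every `ψ⁻¹`-twisted
two-variable Katz–de Shalit branch, `ψ` of type `(1,0)` unramified at `p`, `K` imaginary quadratic,
`5 ≤ p` split.** Greenberg's `μ = 0` for every weight-2 CM newform `θ_ψ` at a split ordinary prime, on the
Katz side (Rubin 1991 §12 dictionary). OPEN (Gillard 1991 p. 14; tree: `SplitPrimeMuVanishing` "emphatically
not the cyclotomic line"). Nothing asserted. -/
def CycKatzUnitContentAt (p : ℕ) [Fact p.Prime] : Prop :=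
  ∀ (K : Type) [Field K] [NumberField K], 5 ≤ p → IsImaginaryQuadratic K →
    ∀ (ψ : HeckeCharacter K), ψ.HasInfinityType (fun _ ↦ 1) (fun _ ↦ 0) →
    ∀ (ι : PadicAlgCl p ≃+* ℂ) (v vbar : IsDedekindDomain.HeightOneSpectrum (NumberField.RingOfIntegers K)),
      ((p : ℕ) : NumberField.RingOfIntegers K) ∈ v.asIdeal →
      ((p : ℕ) : NumberField.RingOfIntegers K) ∈ vbar.asIdeal → vbar ≠ v →
      (∀ (w : NumberField.InfinitePlace K) (k : NumberField.RingOfIntegers K),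
        k ∈ v.asIdeal ↔ ‖ι.symm (w.embedding (k : K))‖ < 1) →
    ∀ (S : Finset (IsDedekindDomain.HeightOneSpectrum (NumberField.RingOfIntegers K))), v ∉ S → vbar ∉ S →
      (∀ w ∈ S, ¬ ψ.IsUnramifiedAt w) →
      (∀ w : IsDedekindDomain.HeightOneSpectrum (NumberField.RingOfIntegers K), w ∉ S → ψ.IsUnramifiedAt w) →
    ∀ (κ₁ κ₂ : ZpExtension K p) (γ₁ γ₂ : Field.absoluteGaloisGroup K),
      ZpExtension.IsTopGeneratorPair κ₁ κ₂ γ₁ γ₂ → κ₂.IsCyclotomic →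
      (∃ ζ : (PadicInt p)ˣ, IsOfFinOrder ζ ∧
        ((GaloisRep.cyclotomicCharacter K p γ₂ * ζ : (PadicInt p)ˣ) : PadicInt p) =
          (cyclotomicGenerator p : PadicInt p)) →
    ∀ (Ω δ : ℂ) (Ωp : PadicComplex p), Ω ≠ 0 → Ωp ≠ 0 →
      (δ ^ 2 = (NumberField.discr K : ℂ) ∨ δ ^ 2 = -(NumberField.discr K : ℂ)) →
    ∀ (G : PowerSeries (PowerSeries (PadicComplexInt p))),
      IsKatzMeasure₂ ι v vbar S κ₁ κ₂ γ₁ γ₂ ψ⁻¹ Ω δ Ωp G →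
      HasUnitContent (PowerSeries.constantCoeff G)

/-- **C⁺ contains the open core of K6's crux 19234 on the Katz side** (conclusion of the OPEN stub
`stub_unitContentCycAxis` of line «katz-cyc-axis», for every CM anchor package): instantiation of
`CycKatzUnitContentAt p` at `K` = the CM field of `A.j`, `ψ = ψ_A`. PROVED. -/
theorem katzAxis_of_cycKatzUnitContentAt {p : ℕ} [Fact p.Prime] (h : CycKatzUnitContentAt p)
    (A : WeierstrassCurve ℚ) [A.IsElliptic] (hp : 5 ≤ p) (hj : A.j ∈ maximalCMJInvariants)
    (K : Type) [Field K] [NumberField K] (hK : IsCMFieldOfJ K A.j)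
    (ψ : HeckeCharacter K) (hψ : ψ.HasInfinityType (fun _ ↦ 1) (fun _ ↦ 0))
    (ι : PadicAlgCl p ≃+* ℂ) (v vbar : IsDedekindDomain.HeightOneSpectrum (NumberField.RingOfIntegers K))
    (hv : ((p : ℕ) : NumberField.RingOfIntegers K) ∈ v.asIdeal)
    (hvbar : ((p : ℕ) : NumberField.RingOfIntegers K) ∈ vbar.asIdeal) (hne : vbar ≠ v)
    (hι : ∀ (w : NumberField.InfinitePlace K) (k : NumberField.RingOfIntegers K),
      k ∈ v.asIdeal ↔ ‖ι.symm (w.embedding (k : K))‖ < 1)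
    (S : Finset (IsDedekindDomain.HeightOneSpectrum (NumberField.RingOfIntegers K)))
    (hvS : v ∉ S) (hvbarS : vbar ∉ S) (hSram : ∀ w ∈ S, ¬ ψ.IsUnramifiedAt w)
    (hSunr : ∀ w : IsDedekindDomain.HeightOneSpectrum (NumberField.RingOfIntegers K),
      w ∉ S → ψ.IsUnramifiedAt w)
    (κ₁ κ₂ : ZpExtension K p) (γ₁ γ₂ : Field.absoluteGaloisGroup K)
    (hpair : ZpExtension.IsTopGeneratorPair κ₁ κ₂ γ₁ γ₂) (hcyc : κ₂.IsCyclotomic)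
    (hγ₂ : ∃ ζ : (PadicInt p)ˣ, IsOfFinOrder ζ ∧
      ((GaloisRep.cyclotomicCharacter K p γ₂ * ζ : (PadicInt p)ˣ) : PadicInt p) =
        (cyclotomicGenerator p : PadicInt p))
    (Ω δ : ℂ) (Ωp : PadicComplex p) (hΩ : Ω ≠ 0) (hΩp : Ωp ≠ 0)
    (hδ : δ ^ 2 = (NumberField.discr K : ℂ) ∨ δ ^ 2 = -(NumberField.discr K : ℂ))
    (G : PowerSeries (PowerSeries (PadicComplexInt p)))
    (hG : IsKatzMeasure₂ ι v vbar S κ₁ κ₂ γ₁ γ₂ ψ⁻¹ Ω δ Ωp G) :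
    HasUnitContent (PowerSeries.constantCoeff G) :=
  h K hp (Deuring_exists_heckeCharacter_of_maximalCM.isImaginaryQuadratic hj hK) ψ hψ ι v vbar hv hvbar
    hne hι S hvS hvbarS hSram hSunr κ₁ κ₂ γ₁ γ₂ hpair hcyc hγ₂ Ω δ Ωp hΩ hΩp hδ G hG

/-- **Unit content of the inner line = its reduction mod `𝔪_{𝒪_{ℂ_p}}` is non-zero** (`T₁ ∤ Ḡ`):
bookkeeping restatement through the tree lemma `hasUnitContent_iff_map_residue_ne_zero`. PROVED. -/
theorem hasUnitContent_constantCoeff_iff_residue {p : ℕ} [Fact p.Prime]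
    (G : PowerSeries (PowerSeries (PadicComplexInt p))) :
    HasUnitContent (PowerSeries.constantCoeff G) ↔
      PowerSeries.map (IsLocalRing.residue (PadicComplexInt p)) (PowerSeries.constantCoeff G) ≠ 0 :=
  hasUnitContent_iff_map_residue_ne_zero (PowerSeries.constantCoeff G)

end Summit.BirchSwinnertonDyer.BirchSwinnertonDyer.Cruxes.UpperNonSurjFive.KatzSide
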